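import Literature.NumberTheory.Transcendental.NashCubes
import Mathlib.MeasureTheory.Function.Jacobian
import Mathlib.Analysis.Calculus.Deriv.Pi
import Mathlib.Analysis.Calculus.Deriv.Inv
import Mathlib.Analysis.Calculus.FDeriv.Mul
import Mathlib.LinearAlgebra.Matrix.Adjugate

/-!
# `MzvKernelInKZ` (stmt-KontsevichZagierPeriods-3914), line two-posets-interior-landen: stub `stub_interiorLanden`, tools I

First support file of the stub `stub_interiorLanden` (the interior Landen identity `E′` with
spectators as a chain of moves of the Kontsevich–Zagier calculus; assembled in
`MzvKernelInKZTwoPosetsInteriorLanden.lean`). No definitions are introduced: the objects are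
written out (file-local notation only). Contents:

* **One-coordinate substitutions.** For a map `y ↦ update y k (g y)` of `ℝⁿ` replacing the single
  coordinate `k` by a differentiable function `g`, the derivative is the identity with the `k`-th
  row replaced by `g'`, its determinant is the diagonal entry (Cramer's rule on the identity), and
  that entry is the derivative of `g` along the `k`-th coordinate line (`stub_interiorLandenAux1`).
  All changes of variables of the chain are of this form or composites of two of them, so no
  Jacobian matrix with spectator columns is ever written down.
* **The Möbius involution** `φ_y(t) = (1 - t)/(1 - y t)` of `(0,1)` for a modulus `y < 1`.
* **Coordinates** on `(0,1)^{m+2}`: `v = x 0`, spectators `x (i+1)` (`i < m`), `r = x (m+1)`,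
  modulus `y = ∏ x (i+1)`; the open cube and the half-cubes `D_A = {r < v}`, `D_B = {v < r}`.
* **Move 1 map** `Φ₁ (v, p, r) = (v, p, r/v)`: a bijection `D_A → cube`, `ℚ`-semialgebraic,
  Jacobian determinant `1/v`.

References: M. Kontsevich, D. Zagier, *Periods* (2001), §1.2 rule (2); J. Bochnak, M. Coste,
M.-F. Roy, *Real Algebraic Geometry* (1998), §2.2.
-/
noncomputable section

namespace Summit.KontsevichZagierPeriods.MzvKernelInKZ.TwoPosets.Landen

open Set MeasureTheory
open Literature.NumberTheory.Transcendental

/-- The identity matrix with the `k`-th row replaced by `g'`, as a continuous linear map. -/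
local notation "updD⟪" k ", " g' "⟫" => ContinuousLinearMap.pi
  (Function.update (fun i => ContinuousLinearMap.proj (R := ℝ) (φ := fun _ => ℝ) i) k g')

/-! ## Maps replacing one coordinate -/

section update

variable {n : ℕ}

/-- Coordinates of `updD⟪k, g'⟫ v`. -/
theorem updD_apply (k : Fin n) (g' : (Fin n → ℝ) →L[ℝ] ℝ) (v : Fin n → ℝ) (i : Fin n) :
    (updD⟪k, g'⟫ : (Fin n → ℝ) →L[ℝ] (Fin n → ℝ)) v i = if i = k then g' v else v i := by
  rw [ContinuousLinearMap.pi_apply]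
  by_cases hi : i = k
  · subst hi; simp
  · rw [Function.update_of_ne hi, if_neg hi]; rfl

/-- The one-coordinate substitution `y ↦ update y k (g y)` has derivative `updD⟪k, g'⟫`. -/
theorem hasFDerivAt_update_of_hasFDerivAt (k : Fin n) {g : (Fin n → ℝ) → ℝ}
    {g' : (Fin n → ℝ) →L[ℝ] ℝ} {x : Fin n → ℝ} (hg : HasFDerivAt g g' x) :
    HasFDerivAt (fun y => Function.update y k (g y))
      (updD⟪k, g'⟫ : (Fin n → ℝ) →L[ℝ] (Fin n → ℝ)) x := by
  rw [hasFDerivAt_pi']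
  intro i
  rw [ContinuousLinearMap.proj_pi]
  by_cases hi : i = k
  · subst hi
    simp only [Function.update_self]
    exact hg
  · simp only [Function.update_of_ne hi]
    exact hasFDerivAt_apply i x

/-- The determinant of `updD⟪k, g'⟫` is the diagonal entry `g' e_k` (Cramer's rule applied to
the identity matrix with one row replaced). -/
theorem det_updD (k : Fin n) (g' : (Fin n → ℝ) →L[ℝ] ℝ) :
    (updD⟪k, g'⟫ : (Fin n → ℝ) →L[ℝ] (Fin n → ℝ)).det = g' (Pi.single k 1) := by
  have hM : LinearMap.toMatrix'
      ((updD⟪k, g'⟫ : (Fin n → ℝ) →L[ℝ] (Fin n → ℝ)) : (Fin n → ℝ) →ₗ[ℝ] (Fin n → ℝ)) =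
      Matrix.updateRow (1 : Matrix (Fin n) (Fin n) ℝ) k (fun j => g' (Pi.single j 1)) := by
    ext i j
    rw [LinearMap.toMatrix'_apply, ContinuousLinearMap.coe_coe, updD_apply]
    by_cases hi : i = k
    · subst hi
      rw [if_pos rfl, Matrix.updateRow_self]
    · rw [if_neg hi, Matrix.updateRow_ne hi, Matrix.one_apply, Pi.single_apply]
  rw [ContinuousLinearMap.det, ← LinearMap.det_toMatrix', hM, ← Matrix.det_transpose,
    ← Matrix.updateCol_transpose, Matrix.transpose_one, ← Matrix.cramer_apply, Matrix.cramer_one]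
  simp

/-- The diagonal entry `g' e_k` of a derivative is the derivative along the `k`-th coordinate
line. -/
theorem apply_single_eq_of_hasDerivAt (k : Fin n) {g : (Fin n → ℝ) → ℝ}
    {g' : (Fin n → ℝ) →L[ℝ] ℝ} {x : Fin n → ℝ} (hg : HasFDerivAt g g' x) {d : ℝ}
    (hd : HasDerivAt (fun t => g (Function.update x k t)) d (x k)) :
    g' (Pi.single k 1) = d := by
  have h1 : HasFDerivAt g g' (Function.update x k (x k)) := by
    rw [Function.update_eq_self]; exact hg
  have h2 : HasDerivAt (fun t => g (Function.update x k t)) (g' (Pi.single k 1)) (x k) :=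
    h1.comp_hasDerivAt (x k) (hasDerivAt_update x k (x k))
  exact h2.unique hd

/-- Packaged: the one-coordinate substitution `y ↦ update y k (g y)` by a differentiable `g` is
differentiable with derivative `updD⟪k, fderiv g x⟫`, whose determinant is the derivative of `g`
along the `k`-th coordinate line. -/
theorem hasFDerivAt_update_det (k : Fin n) {g : (Fin n → ℝ) → ℝ} {x : Fin n → ℝ}
    (hg : DifferentiableAt ℝ g x) {d : ℝ}
    (hd : HasDerivAt (fun t => g (Function.update x k t)) d (x k)) :
    HasFDerivAt (fun y => Function.update y k (g y))
        (updD⟪k, fderiv ℝ g x⟫ : (Fin n → ℝ) →L[ℝ] (Fin n → ℝ)) x ∧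
      (updD⟪k, fderiv ℝ g x⟫ : (Fin n → ℝ) →L[ℝ] (Fin n → ℝ)).det = d :=
  ⟨hasFDerivAt_update_of_hasFDerivAt k hg.hasFDerivAt,
    by rw [det_updD, apply_single_eq_of_hasDerivAt k hg.hasFDerivAt hd]⟩

/-- **Principal tool** (registered support of `stub_interiorLanden`): a one-coordinate
substitution `y ↦ update y k (g y)` of `ℝⁿ` by a differentiable `g` is differentiable, and its
Jacobian determinant is the ordinary derivative of `g` along the `k`-th coordinate line. -/
theorem stub_interiorLandenAux1 : ∀ {n : ℕ} (k : Fin n) (g : (Fin n → ℝ) → ℝ) (x : Fin n → ℝ) (d : ℝ), DifferentiableAt ℝ g x → HasDerivAt (fun t => g (Function.update x k t)) d (x k) → ∃ L : (Fin n → ℝ) →L[ℝ] (Fin n → ℝ), HasFDerivAt (fun y => Function.update y k (g y)) L x ∧ L.det = d :=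
  fun k _ _ _ hg hd => ⟨_, hasFDerivAt_update_det k hg hd⟩

/-- Quotients of differentiable real functions on `ℝⁿ` are differentiable off the zeros of the
denominator. -/
theorem differentiableAt_div {f g : (Fin n → ℝ) → ℝ} {x : Fin n → ℝ}
    (hf : DifferentiableAt ℝ f x) (hg : DifferentiableAt ℝ g x) (h : g x ≠ 0) :
    DifferentiableAt ℝ (fun y => f y / g y) x := by
  simp_rw [div_eq_mul_inv]
  exact hf.mul (hg.inv h)

/-- Monomials in the coordinates are differentiable. -/
theorem differentiableAt_prod_coord {ι : Type*} [Fintype ι] [DecidableEq ι] (e : ι → Fin n)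
    (x : Fin n → ℝ) : DifferentiableAt ℝ (fun y : Fin n → ℝ => ∏ i, y (e i)) x :=
  (HasFDerivAt.finsetProd (fun i _ => hasFDerivAt_apply (e i) x)).differentiableAt

end update

/-! ## The Möbius involution `φ_y(t) = (1 - t)/(1 - y t)` -/

/-- `φ_y(t) = (1 - t) / (1 - y t)`. -/
local notation "φ⟪" y ", " t "⟫" => (1 - t) / (1 - y * t)

section phi

variable {y t s : ℝ}

/-- `1 - y t > 0` for `y < 1`, `t ∈ (0,1)`. -/
theorem one_sub_mul_pos (hy : y < 1) (ht0 : 0 < t) (ht1 : t < 1) : 0 < 1 - y * t := by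
  nlinarith

/-- `φ_y(t) > 0` on `(0,1)`. -/
theorem phi_pos (hy : y < 1) (ht0 : 0 < t) (ht1 : t < 1) : 0 < φ⟪y, t⟫ :=
  div_pos (by linarith) (one_sub_mul_pos hy ht0 ht1)

/-- `φ_y(t) < 1` on `(0,1)`. -/
theorem phi_lt_one (hy : y < 1) (ht0 : 0 < t) (ht1 : t < 1) : φ⟪y, t⟫ < 1 := by
  rw [div_lt_one (one_sub_mul_pos hy ht0 ht1)]
  nlinarith

/-- `1 - y φ_y(t) = (1 - y)/(1 - y t)`. -/
theorem one_sub_y_mul_phi (h : 1 - y * t ≠ 0) : 1 - y * φ⟪y, t⟫ = (1 - y) / (1 - y * t) := by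
  field_simp; ring

/-- `1 - φ_y(t) = t (1 - y)/(1 - y t)`. -/
theorem one_sub_phi (h : 1 - y * t ≠ 0) : 1 - φ⟪y, t⟫ = t * (1 - y) / (1 - y * t) := by
  rw [eq_div_iff h, sub_mul, div_mul_cancel₀ _ h]; ring

/-- `φ_y` is an involution. -/
theorem phi_phi (hy : y ≠ 1) (h : 1 - y * t ≠ 0) : φ⟪y, φ⟪y, t⟫⟫ = t := by
  have hy' : (1 - y) ≠ 0 := sub_ne_zero.mpr (Ne.symm hy)
  rw [one_sub_y_mul_phi h, one_sub_phi h, div_div_div_cancel_right₀ h, mul_div_assoc,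
    div_self hy', mul_one]

/-- `φ_y` is strictly decreasing on `(0,1)`. -/
theorem phi_lt_phi (hy : y < 1) (ht0 : 0 < t) (ht1 : t < 1) (hs0 : 0 < s) (hs1 : s < 1)
    (hts : t < s) : φ⟪y, s⟫ < φ⟪y, t⟫ := by
  rw [div_lt_div_iff₀ (one_sub_mul_pos hy hs0 hs1) (one_sub_mul_pos hy ht0 ht1)]
  nlinarith

/-- `φ_y'(t) = -(1 - y)/(1 - y t)²`. -/
theorem hasDerivAt_phi (h : 1 - y * t ≠ 0) :
    HasDerivAt (fun t : ℝ => φ⟪y, t⟫) (-(1 - y) / (1 - y * t) ^ 2) t := by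
  have h1 : HasDerivAt (fun t : ℝ => 1 - t) (-1) t := by
    simpa using (hasDerivAt_id t).const_sub 1
  have h2 : HasDerivAt (fun t : ℝ => 1 - y * t) (-y) t := by
    simpa using ((hasDerivAt_id t).const_mul y).const_sub 1
  refine (h1.div h2 h).congr_deriv ?_
  field_simp
  ring

/-- `|φ_y'(t)| = (1 - y)/(1 - y t)²` on `(0,1)`. -/
theorem abs_deriv_phi (hy : y < 1) (ht0 : 0 < t) (ht1 : t < 1) :
    |-(1 - y) / (1 - y * t) ^ 2| = (1 - y) / (1 - y * t) ^ 2 := by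
  rw [abs_div, abs_neg, abs_of_pos (by linarith), abs_of_pos (pow_pos (one_sub_mul_pos hy ht0 ht1) 2)]

end phi

/-! ## Coordinates on `ℝ^{m+2}`: the modulus and the domains -/

/-- The modulus `y = p₁ ⋯ p_m`: the product of the spectator coordinates `x (i+1)`, `i < m`. -/
local notation "ymod⟪" m ", " x "⟫" => ∏ i : Fin m, x (Fin.castSucc (Fin.succ i))

set_option quotPrecheck false in
/-- The open cube `(0,1)^{m+2}` (literally the line's `cube (m + 2)`). -/
local notation "cub⟪" m "⟫" => {x : Fin (m + 2) → ℝ | ∀ i, 0 < x i ∧ x i < 1}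

set_option quotPrecheck false in
/-- `D_A = {x ∈ (0,1)^{m+2} | r < v}`. -/
local notation "DA⟪" m "⟫" =>
  {x : Fin (m + 2) → ℝ | (∀ i, 0 < x i ∧ x i < 1) ∧ x (Fin.last (m + 1)) < x 0}

set_option quotPrecheck false in
/-- `D_B = {x ∈ (0,1)^{m+2} | v < r}`. -/
local notation "DB⟪" m "⟫" =>
  {x : Fin (m + 2) → ℝ | (∀ i, 0 < x i ∧ x i < 1) ∧ x 0 < x (Fin.last (m + 1))}

/-- The modulus polynomial `∏ X_{i+1}` over `ℚ`. -/
local notation "Ypoly⟪" m "⟫" =>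
  ∏ i : Fin m, (MvPolynomial.X (Fin.castSucc (Fin.succ i)) : MvPolynomial (Fin (m + 2)) ℚ)

/-- The move-1 map `Φ₁ (v, p, r) = (v, p, r/v)` (the substitution `s = r/v`). -/
local notation "Φ₁⟪" m "⟫" => fun x : Fin (m + 2) → ℝ =>
  Function.update x (Fin.last (m + 1)) (x (Fin.last (m + 1)) / x 0)

section coords

variable {m : ℕ}

/-- Spectator indices are not `0`. -/
theorem spec_ne_zero (i : Fin m) : Fin.castSucc (Fin.succ i) ≠ (0 : Fin (m + 2)) :=
  fun h => by simpa using congrArg Fin.val h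

/-- Spectator indices are not the last index. -/
theorem spec_ne_last (i : Fin m) : Fin.castSucc (Fin.succ i) ≠ Fin.last (m + 1) :=
  (Fin.castSucc_lt_last _).ne

/-- `0` is not the last index. -/
theorem zero_ne_last : (0 : Fin (m + 2)) ≠ Fin.last (m + 1) :=
  fun h => by simpa using congrArg Fin.val h

/-- The modulus does not see the coordinate `v`. -/
theorem ymod_update_zero (x : Fin (m + 2) → ℝ) (v : ℝ) :
    ymod⟪m, Function.update x 0 v⟫ = ymod⟪m, x⟫ :=
  Finset.prod_congr rfl fun i _ => Function.update_of_ne (spec_ne_zero i) _ _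

/-- The modulus does not see the coordinate `r`. -/
theorem ymod_update_last (x : Fin (m + 2) → ℝ) (v : ℝ) :
    ymod⟪m, Function.update x (Fin.last (m + 1)) v⟫ = ymod⟪m, x⟫ :=
  Finset.prod_congr rfl fun i _ => Function.update_of_ne (spec_ne_last i) _ _

/-- `0 < y` on the cube. -/
theorem ymod_pos {x : Fin (m + 2) → ℝ} (hx : ∀ i, 0 < x i ∧ x i < 1) : 0 < ymod⟪m, x⟫ :=
  Finset.prod_pos fun i _ => (hx (Fin.castSucc (Fin.succ i))).1

/-- `y ≤ 1` on the cube. -/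
theorem ymod_le_one {x : Fin (m + 2) → ℝ} (hx : ∀ i, 0 < x i ∧ x i < 1) : ymod⟪m, x⟫ ≤ 1 :=
  Finset.prod_le_one (fun _ _ => (hx _).1.le) fun i _ => (hx (Fin.castSucc (Fin.succ i))).2.le

/-- `y < 1` on the cube as soon as there is a spectator. -/
theorem ymod_lt_one (hm : 1 ≤ m) {x : Fin (m + 2) → ℝ} (hx : ∀ i, 0 < x i ∧ x i < 1) :
    ymod⟪m, x⟫ < 1 := by
  rw [← Finset.mul_prod_erase (Finset.univ : Finset (Fin m))
    (fun i : Fin m => x (Fin.castSucc (Fin.succ i))) (Finset.mem_univ ⟨0, hm⟩)]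
  refine mul_lt_one_of_nonneg_of_lt_one_left (hx _).1.le (hx _).2 ?_
  exact Finset.prod_le_one (fun _ _ => (hx _).1.le) fun i _ => (hx (Fin.castSucc (Fin.succ i))).2.le

/-- `y t < 1` for `t ∈ (0,1)` on the cube. -/
theorem ymod_mul_lt_one {x : Fin (m + 2) → ℝ} (hx : ∀ i, 0 < x i ∧ x i < 1) {t : ℝ}
    (ht0 : 0 < t) (ht1 : t < 1) : ymod⟪m, x⟫ * t < 1 :=
  mul_lt_one_of_nonneg_of_lt_one_right (ymod_le_one hx) ht0.le ht1

/-- The modulus is the value of the modulus polynomial. -/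
theorem aeval_Ypoly (x : Fin (m + 2) → ℝ) : MvPolynomial.aeval x Ypoly⟪m⟫ = ymod⟪m, x⟫ := by
  simp [map_prod]

/-- Basic inequalities on the cube with `m ≥ 1` spectators: the fibre coordinates and the
modulus lie in `(0,1)`, and `1 - y v > 0`, `1 - y r > 0`. -/
theorem cub_facts (hm : 1 ≤ m) {x : Fin (m + 2) → ℝ} (hx : x ∈ cub⟪m⟫) :
    0 < x 0 ∧ x 0 < 1 ∧ 0 < x (Fin.last (m + 1)) ∧ x (Fin.last (m + 1)) < 1 ∧
      0 < ymod⟪m, x⟫ ∧ ymod⟪m, x⟫ < 1 ∧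
      0 < 1 - ymod⟪m, x⟫ * x 0 ∧ 0 < 1 - ymod⟪m, x⟫ * x (Fin.last (m + 1)) :=
  ⟨(hx 0).1, (hx 0).2, (hx _).1, (hx _).2, ymod_pos hx, ymod_lt_one hm hx,
    one_sub_mul_pos (ymod_lt_one hm hx) (hx 0).1 (hx 0).2,
    one_sub_mul_pos (ymod_lt_one hm hx) (hx _).1 (hx _).2⟩

/-- The cube is `ℚ`-semialgebraic (it is the tree's `openUnitCube (m + 2)`, definitionally). -/
theorem isSemialgebraic_cub : Literature.ModelTheory.ExponentialFields.IsSemialgebraic ℚ cub⟪m⟫ :=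
  isSemialgebraic_openUnitCube

/-- Coordinate order cells `{x_i < x_j}` are `ℚ`-semialgebraic. -/
theorem isSemialgebraic_setOf_lt (i j : Fin (m + 2)) :
    Literature.ModelTheory.ExponentialFields.IsSemialgebraic ℚ {x : Fin (m + 2) → ℝ | x i < x j} := by
  simpa using Literature.ModelTheory.ExponentialFields.isSemialgebraic_setOf_eval_lt (k := ℚ)
    (R := ℝ) (MvPolynomial.X i : MvPolynomial (Fin (m + 2)) ℚ) (MvPolynomial.X j)

/-- `D_A` is `ℚ`-semialgebraic. -/
theorem isSemialgebraic_DA : Literature.ModelTheory.ExponentialFields.IsSemialgebraic ℚ DA⟪m⟫ :=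
  isSemialgebraic_cub.inter (isSemialgebraic_setOf_lt _ _)

/-- `D_B` is `ℚ`-semialgebraic. -/
theorem isSemialgebraic_DB : Literature.ModelTheory.ExponentialFields.IsSemialgebraic ℚ DB⟪m⟫ :=
  isSemialgebraic_cub.inter (isSemialgebraic_setOf_lt _ _)

/-- The cube is measurable. -/
theorem measurableSet_cub : MeasurableSet cub⟪m⟫ :=
  Literature.ModelTheory.ExponentialFields.IsSemialgebraic.measurableSet_holds isSemialgebraic_cub

/-- `D_A` is measurable. -/
theorem measurableSet_DA : MeasurableSet DA⟪m⟫ :=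
  Literature.ModelTheory.ExponentialFields.IsSemialgebraic.measurableSet_holds isSemialgebraic_DA

/-- `D_B` is measurable. -/
theorem measurableSet_DB : MeasurableSet DB⟪m⟫ :=
  Literature.ModelTheory.ExponentialFields.IsSemialgebraic.measurableSet_holds isSemialgebraic_DB

/-- `D_A ⊆ cube`. -/
theorem DA_subset_cub : DA⟪m⟫ ⊆ cub⟪m⟫ := fun _ hx => hx.1

/-- `D_B ⊆ cube`. -/
theorem DB_subset_cub : DB⟪m⟫ ⊆ cub⟪m⟫ := fun _ hx => hx.1

/-! ### Move 1 map `Φ₁ (v, p, r) = (v, p, r/v) : D_A → cube` -/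

/-- `Φ₁` maps `D_A` into the cube. -/
theorem Phi1_mem_cub {x : Fin (m + 2) → ℝ} (hx : x ∈ DA⟪m⟫) : Φ₁⟪m⟫ x ∈ cub⟪m⟫ := by
  obtain ⟨hc, hlt⟩ := hx
  intro i
  by_cases hi : i = Fin.last (m + 1)
  · subst hi
    simp only [Function.update_self]
    exact ⟨div_pos (hc _).1 (hc _).1, (div_lt_one (hc _).1).mpr hlt⟩
  · simp only [Function.update_of_ne hi]
    exact hc i

/-- `Φ₁` maps `D_A` onto the cube. -/
theorem image_Phi1 : Φ₁⟪m⟫ '' DA⟪m⟫ = cub⟪m⟫ := by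
  refine Subset.antisymm ?_ ?_
  · rintro _ ⟨x, hx, rfl⟩; exact Phi1_mem_cub hx
  · intro z hz
    refine ⟨Function.update z (Fin.last (m + 1)) (z 0 * z (Fin.last (m + 1))), ⟨fun i => ?_, ?_⟩, ?_⟩
    · by_cases hi : i = Fin.last (m + 1)
      · subst hi
        simp only [Function.update_self]
        exact ⟨mul_pos (hz _).1 (hz _).1,
          mul_lt_one_of_nonneg_of_lt_one_left (hz _).1.le (hz _).2 (hz _).2.le⟩
      · simp only [Function.update_of_ne hi]; exact hz i
    · simp only [Function.update_self, Function.update_of_ne zero_ne_last]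
      exact mul_lt_of_lt_one_right (hz _).1 (hz _).2
    · funext i
      by_cases hi : i = Fin.last (m + 1)
      · subst hi
        simp only [Function.update_self, Function.update_of_ne zero_ne_last]
        field_simp [(hz 0).1.ne']
      · simp only [Function.update_of_ne hi]

/-- `Φ₁` is injective on `D_A`. -/
theorem injOn_Phi1 : InjOn Φ₁⟪m⟫ DA⟪m⟫ := by
  intro x hx z hz h
  have h0 : x 0 = z 0 := by
    simpa only [Function.update_of_ne zero_ne_last] using congrFun h 0
  funext i
  by_cases hi : i = Fin.last (m + 1)
  · subst hi
    have := congrFun h (Fin.last (m + 1))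
    simp only [Function.update_self] at this
    rw [h0] at this
    exact (div_left_inj' (hz.1 0).1.ne').mp this
  · simpa only [Function.update_of_ne hi] using congrFun h i

/-- `Φ₁` is a quotient of `ℚ`-polynomials coordinatewise, hence `ℚ`-semialgebraic on `D_A`. -/
theorem isSemialgebraicMapOn_Phi1 : IsSemialgebraicMapOn ℚ DA⟪m⟫ Φ₁⟪m⟫ := by
  refine IsSemialgebraicMapOn.of_forall isSemialgebraic_DA fun j => ?_
  by_cases hj : j = Fin.last (m + 1)
  · subst hj
    refine (isSemialgebraicFunOn_aeval_div_aeval isSemialgebraic_DA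
      (MvPolynomial.X (Fin.last (m + 1))) (MvPolynomial.X 0) fun x hx => ?_).congr fun x hx => ?_
    · simpa using (hx.1 0).1.ne'
    · simp
  · refine (isSemialgebraicFunOn_aeval isSemialgebraic_DA (MvPolynomial.X j)).congr fun x hx => ?_
    simp [Function.update_of_ne hj]

/-- `Φ₁` is differentiable at every `x` with `x_0 ≠ 0`, with Jacobian determinant `1 / x_0`:
there is a derivative field (a one-coordinate substitution derivative). -/
theorem hasFDerivAt_Phi1 : ∃ D : (Fin (m + 2) → ℝ) → ((Fin (m + 2) → ℝ) →L[ℝ] (Fin (m + 2) → ℝ)),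
    ∀ x : Fin (m + 2) → ℝ, x 0 ≠ 0 → HasFDerivAt Φ₁⟪m⟫ (D x) x ∧ (D x).det = 1 / x 0 := by
  refine ⟨fun x => updD⟪Fin.last (m + 1),
    fderiv ℝ (fun y : Fin (m + 2) → ℝ => y (Fin.last (m + 1)) / y 0) x⟫, fun x h0 => ?_⟩
  have hg : DifferentiableAt ℝ (fun y : Fin (m + 2) → ℝ => y (Fin.last (m + 1)) / y 0) x :=
    differentiableAt_div (differentiableAt_apply _ x) (differentiableAt_apply 0 x) h0
  have hd : HasDerivAt (fun t => (Function.update x (Fin.last (m + 1)) t) (Fin.last (m + 1)) /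
      (Function.update x (Fin.last (m + 1)) t) 0) (1 / x 0) (x (Fin.last (m + 1))) := by
    simp only [Function.update_self, Function.update_of_ne zero_ne_last]
    simpa using (hasDerivAt_id (x (Fin.last (m + 1)))).div_const (x 0)
  exact hasFDerivAt_update_det (Fin.last (m + 1)) hg hd

end coords

end Summit.KontsevichZagierPeriods.MzvKernelInKZ.TwoPosets.Landen
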